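import Summits.AtomisticToContinuum.FouriersLaw.Theses.CageBudgetFekete
import Summits.AtomisticToContinuum.FouriersLaw.Theorems.HoelderEscapeProfileFibreCalculus
import Summits.AtomisticToContinuum.FouriersLaw.Theorems.CageBudgetFeketeUnboundedHeatVarianceIrOfNoFrozenSiteEnergy
import Literature.Analysis.Asymptotics.WidderAbelianLaplaceProofs
import Literature.MathematicalPhysics.KineticTheory.InfiniteChainCurrentPositiveType
import HarnessLib

/-!
# `CageBudgetFekete.UnboundedHeatVariance`, line Sketch — ergodic time-one map ⟹ no frozen site energy

Support file (`--supports stmt-AtomisticToContinuum-15771`) for the stub `stub_noFrozenSiteEnergy_of_ergodic`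
(edge "Erg") of line `Sketch`.

In the arena of the crux let `h_x` be the split-bond site energy (`OscillatorChain.energyDensityZ`),
`m = ∫ h₀ dμ`, `f = h₀ - m ∈ L²(μ)` (superstability moments), `S(0,t) = ∫ f · (f ∘ φ_t) dμ` the on-site energy
kernel and `S̄_ν(0) = ν ∫₀^∞ e^{-νt} S(0,t) dt` its Abel mean. If the time-one map `φ₁ = D.flow 1` is ERGODIC
for `μ` (Mathlib `Ergodic`), then `S̄_ν(0) → 0` as `ν ↓ 0`:

* `tendsto_cesaro_integral_mul_comp_iterate_of_ergodic` — von Neumann's mean ergodic theorem (Mathlib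
  `ContinuousLinearMap.tendsto_birkhoffAverage_orthogonalProjection`) for the Koopman isometry of an ergodic map
  on `L²(μ)`: the Birkhoff averages of `g` converge in `L²` to a fixed vector, a.e. constant by ergodicity
  (`Ergodic.ae_eq_const_of_ae_eq_comp_ae`), so `N⁻¹ Σ_{n<N} ∫ f (g ∘ T^[n]) → 0` for centred `f`;
* applied to `T = φ₁`, `g = f ∘ φ_θ` and the a.e. group law (`(φ₁)^[n] = φ_n` on the carrier):
  `N⁻¹ Σ_{n<N} S(0, θ + n) → 0` for every phase `θ`;
* `tendsto_setIntegral_div_of_cesaro` — `∫₀^N S(0,·) = ∫₀¹ Σ_{n<N} S(0, θ+n) dθ`, bounded convergence in `θ`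
  (`|S(0,t)| ≤ ‖f‖₂²`) and `|∫_N^t S(0,·)| ≤ ‖f‖₂²` give the continuous Cesàro mean `t⁻¹ ∫₀ᵗ S(0,·) → 0`;
* Cesàro ⟹ Abel is the tree's Widder Abelian theorem
  (`Literature.Analysis.Asymptotics.Widder1941_abelian_laplace_one` with `Widder1941_abelian_laplace_holds`),
  whose integrability inputs are clause (3) of the landed fibre calculus
  (`FibreCalculusSketch.fibreCalculus_proof`) and the continuity of `S(0,·)`
  (`InfiniteChainDynamics.continuous_integral_energyDensityZ_mul_flow_pinnedChain`).

Composed with the landed edge E (`stub_infraredNonFreezingOfNoFrozenSiteEnergy`): ergodicity of `φ₁` ⟹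
infrared non-freezing (`infraredNonFreezing_of_ergodic`).
-/

noncomputable section

namespace Summit.AtomisticToContinuum.FouriersLaw.Theorems.UnboundedHeatVariance.Sketch

open MeasureTheory Set Filter Topology Function
open Literature.MathematicalPhysics.KineticTheory.HeatConduction

/-! ### The mean ergodic theorem, scalar form -/

/-- **Ergodic Cesàro decay of centred correlations** (von Neumann's mean ergodic theorem, Mathlib
`ContinuousLinearMap.tendsto_birkhoffAverage_orthogonalProjection`, for the Koopman isometry
`Lp.compMeasurePreservingₗᵢ` of an ERGODIC map `T` on `L²(μ)`): for `f, g ∈ L²(μ)` with `∫ f dμ = 0`,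
`N⁻¹ Σ_{n<N} ∫ f · (g ∘ T^[n]) dμ → 0` — the Birkhoff averages of `g` converge in `L²` to a `T`-invariant vector,
which is a.e. constant (`Ergodic.ae_eq_const_of_ae_eq_comp_ae`), hence orthogonal to the centred `f`. [folklore] -/
theorem tendsto_cesaro_integral_mul_comp_iterate_of_ergodic {α : Type*} [MeasurableSpace α]
    {μ : Measure α} [IsFiniteMeasure μ] {T : α → α} (hT : Ergodic T μ) {f g : α → ℝ}
    (hf : MemLp f 2 μ) (hg : MemLp g 2 μ) (hf0 : ∫ x, f x ∂μ = 0) :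
    Tendsto (fun N : ℕ => (N : ℝ)⁻¹ * ∑ n ∈ Finset.range N, ∫ x, f x * g (T^[n] x) ∂μ)
      atTop (𝓝 0) := by
  haveI : Fact (1 ≤ (2 : ENNReal)) := ⟨by norm_num⟩
  have hTm : MeasurePreserving T μ μ := hT.toMeasurePreserving
  set L : Lp ℝ 2 μ →ₗᵢ[ℝ] Lp ℝ 2 μ := Lp.compMeasurePreservingₗᵢ ℝ T hTm with hL
  set U : Lp ℝ 2 μ →L[ℝ] Lp ℝ 2 μ := L.toContinuousLinearMap with hUdef
  have hU : ‖U‖ ≤ 1 := L.norm_toContinuousLinearMap_le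
  have hUapp : ∀ v : Lp ℝ 2 μ, U v = Lp.compMeasurePreserving T hTm v := fun v => rfl
  set F : Lp ℝ 2 μ := hf.toLp f with hFdef
  set G : Lp ℝ 2 μ := hg.toLp g with hGdef
  have hFf : (F : α → ℝ) =ᵐ[μ] f := hf.coeFn_toLp
  have hGg : (G : α → ℝ) =ᵐ[μ] g := hg.coeFn_toLp
  -- iterates of the Koopman operator act by composition with the iterates of `T`
  have hiter : ∀ n : ℕ, (((U : Lp ℝ 2 μ → Lp ℝ 2 μ)^[n] G : Lp ℝ 2 μ) : α → ℝ) =ᵐ[μ] g ∘ T^[n] := by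
    intro n
    have h1 : (U : Lp ℝ 2 μ → Lp ℝ 2 μ)^[n] G = Lp.compMeasurePreserving T^[n] (hTm.iterate n) G :=
      congrFun (Lp.compMeasurePreserving_iterate (E := ℝ) (p := (2 : ENNReal)) hTm n) G
    rw [h1]
    exact (Lp.coeFn_compMeasurePreserving G _).trans
      ((hTm.iterate n).quasiMeasurePreserving.ae_eq_comp hGg)
  -- the inner products against `F` are the correlations
  have hinner : ∀ n : ℕ, @inner ℝ _ _ F ((U : Lp ℝ 2 μ → Lp ℝ 2 μ)^[n] G) = ∫ x, f x * g (T^[n] x) ∂μ := by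
    intro n
    rw [MeasureTheory.L2.inner_def]
    refine integral_congr_ae ?_
    filter_upwards [hFf, hiter n] with x hx hx'
    rw [RCLike.inner_apply, conj_trivial, hx', hx, comp_apply, mul_comm]
  -- the limit of the Birkhoff averages of `G` is a `U`-fixed vector
  obtain ⟨p, hpU, hmean⟩ : ∃ p : Lp ℝ 2 μ, U p = p ∧
      Tendsto (fun N : ℕ => birkhoffAverage ℝ U _root_.id N G) atTop (𝓝 p) := by
    let K := U.eqLocus (1 : Lp ℝ 2 μ →L[ℝ] Lp ℝ 2 μ)
    have hm : Tendsto (fun N : ℕ => birkhoffAverage ℝ U _root_.id N G) atTop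
        (𝓝 (K.orthogonalProjectionOnto G : Lp ℝ 2 μ)) :=
      U.tendsto_birkhoffAverage_orthogonalProjection hU G
    refine ⟨_, ?_, hm⟩
    have hmem : (K.orthogonalProjectionOnto G : Lp ℝ 2 μ) ∈ K := SetLike.coe_mem _
    rw [LinearMap.mem_eqLocus] at hmem
    simpa using hmem
  -- which is a.e. constant by ergodicity, hence orthogonal to the centred `F`
  have hpT : ((p : Lp ℝ 2 μ) : α → ℝ) ∘ T =ᵐ[μ] (p : α → ℝ) := by
    have e := Lp.coeFn_compMeasurePreserving p hTm
    rw [← hUapp, hpU] at e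
    exact e.symm
  obtain ⟨c, hc⟩ := hT.ae_eq_const_of_ae_eq_comp_ae (Lp.aestronglyMeasurable p) hpT
  have hFp : @inner ℝ _ _ F p = 0 := by
    rw [MeasureTheory.L2.inner_def]
    have e : (fun x => @inner ℝ _ _ ((F : Lp ℝ 2 μ) x) ((p : Lp ℝ 2 μ) x)) =ᵐ[μ] fun x => f x * c := by
      filter_upwards [hFf, hc] with x hx hx'
      rw [RCLike.inner_apply, conj_trivial, hx', hx, const_apply, mul_comm]
    rw [integral_congr_ae e, integral_mul_const, hf0, zero_mul]
  have hlim : Tendsto (fun N : ℕ => @inner ℝ _ _ F (birkhoffAverage ℝ U _root_.id N G)) atTop (𝓝 0) := by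
    have h := Filter.Tendsto.inner (𝕜 := ℝ) (tendsto_const_nhds (x := F)) hmean
    rwa [hFp] at h
  refine hlim.congr fun N => ?_
  rw [birkhoffAverage, birkhoffSum, inner_smul_right, inner_sum]
  simp only [id_eq, hinner]

/-! ### From Cesàro means along integer progressions to the continuous Cesàro mean -/

/-- **Cesàro means along integer progressions control the continuous Cesàro mean.** For a continuous bounded
`s : ℝ → ℝ` (`|s| ≤ B`) whose arithmetic-progression Cesàro means `N⁻¹ Σ_{n<N} s(θ + n)` tend to `0` for every
phase `θ`, the continuous Cesàro mean `t⁻¹ ∫_{(0,t]} s` tends to `0` as `t → ∞`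
(`∫₀^N s = ∫₀¹ Σ_{n<N} s(θ+n) dθ`, bounded convergence in `θ`, and `|∫_{⌊t⌋}^t s| ≤ B`). [folklore] -/
theorem tendsto_setIntegral_div_of_cesaro {s : ℝ → ℝ} (hs : Continuous s) {B : ℝ}
    (hB : ∀ t, |s t| ≤ B)
    (hces : ∀ θ : ℝ, Tendsto (fun N : ℕ => (N : ℝ)⁻¹ * ∑ n ∈ Finset.range N, s (θ + n)) atTop (𝓝 0)) :
    Tendsto (fun t : ℝ => (∫ u in Ioc 0 t, s u) / t) atTop (𝓝 0) := by
  have hB0 : 0 ≤ B := (abs_nonneg _).trans (hB 0)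
  have hii : ∀ a b : ℝ, IntervalIntegrable s volume a b := fun a b => hs.intervalIntegrable a b
  -- `∫₀^N s = ∫₀¹ Σ_{n<N} s(θ + n) dθ`
  have hsum : ∀ N : ℕ, ∫ u in (0:ℝ)..N, s u = ∫ θ in (0:ℝ)..1, ∑ n ∈ Finset.range N, s (θ + n) := by
    intro N
    rw [intervalIntegral.integral_finsetSum (f := fun (n : ℕ) (θ : ℝ) => s (θ + n))
      (fun n _ => (hs.comp (continuous_add_const _)).intervalIntegrable _ _)]
    have e : ∀ n : ℕ, ∫ θ in (0:ℝ)..1, s (θ + n) = ∫ u in ((n : ℕ) : ℝ)..((n + 1 : ℕ) : ℝ), s u := by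
      intro n
      rw [intervalIntegral.integral_comp_add_right s (n : ℝ)]
      push_cast
      rw [zero_add, add_comm]
    simp_rw [e]
    have h := intervalIntegral.sum_integral_adjacent_intervals (f := s) (μ := volume)
      (a := fun k : ℕ => (k : ℝ)) (n := N) (fun k _ => hii _ _)
    simpa using h.symm
  -- bounded convergence in `θ`: the Cesàro means at integer times tend to `0`
  have hN : Tendsto (fun N : ℕ => (N : ℝ)⁻¹ * ∫ u in (0:ℝ)..N, s u) atTop (𝓝 0) := by
    have e : ∀ N : ℕ, (N : ℝ)⁻¹ * ∫ u in (0:ℝ)..N, s u =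
        ∫ θ in (0:ℝ)..1, (N : ℝ)⁻¹ * ∑ n ∈ Finset.range N, s (θ + n) := by
      intro N
      rw [hsum N, intervalIntegral.integral_const_mul]
    simp_rw [e]
    have h := intervalIntegral.tendsto_integral_filter_of_dominated_convergence (μ := volume) (a := (0:ℝ))
      (b := 1) (F := fun (N : ℕ) (θ : ℝ) => (N : ℝ)⁻¹ * ∑ n ∈ Finset.range N, s (θ + n))
      (f := fun _ => (0:ℝ)) (l := atTop) (fun _ => B) ?_ ?_ ?_ ?_
    · simpa using h
    · refine Eventually.of_forall fun N => Continuous.aestronglyMeasurable ?_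
      fun_prop
    · refine Eventually.of_forall fun N => Eventually.of_forall fun θ _ => ?_
      rw [Real.norm_eq_abs, abs_mul, abs_inv, Nat.abs_cast]
      rcases Nat.eq_zero_or_pos N with hN0 | hNpos
      · subst hN0; simp [hB0]
      · have hNr : (0 : ℝ) < N := by exact_mod_cast hNpos
        calc (N : ℝ)⁻¹ * |∑ n ∈ Finset.range N, s (θ + n)|
            ≤ (N : ℝ)⁻¹ * ∑ n ∈ Finset.range N, |s (θ + n)| := by
              gcongr; exact Finset.abs_sum_le_sum_abs _ _
          _ ≤ (N : ℝ)⁻¹ * ∑ n ∈ Finset.range N, B := by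
              gcongr with n _; exact hB _
          _ = B := by rw [Finset.sum_const, Finset.card_range, nsmul_eq_mul]; field_simp
    · exact intervalIntegrable_const
    · exact Eventually.of_forall fun θ _ => hces θ
  -- from integer to real times
  have hfloor : Tendsto (fun t : ℝ => |((⌊t⌋₊ : ℕ) : ℝ)⁻¹ * ∫ u in (0:ℝ)..((⌊t⌋₊ : ℕ) : ℝ), s u| + B / t)
      atTop (𝓝 0) := by
    have h1 := (hN.comp (tendsto_nat_floor_atTop (α := ℝ))).abs
    have h2 : Tendsto (fun t : ℝ => B / t) atTop (𝓝 0) := tendsto_const_nhds.div_atTop tendsto_id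
    simpa using h1.add h2
  refine squeeze_zero_norm' ?_ hfloor
  filter_upwards [eventually_ge_atTop (1:ℝ)] with t ht
  set N : ℕ := ⌊t⌋₊ with hNdef
  have hN1 : 1 ≤ N := Nat.le_floor (by exact_mod_cast ht)
  have hNt : (N : ℝ) ≤ t := Nat.floor_le (by linarith)
  have htN : t < N + 1 := Nat.lt_floor_add_one t
  have hNpos : (0:ℝ) < N := by exact_mod_cast hN1
  have ht0 : 0 < t := by linarith
  have hsplit : ∫ u in Ioc 0 t, s u = (∫ u in (0:ℝ)..N, s u) + ∫ u in (N:ℝ)..t, s u := by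
    rw [← intervalIntegral.integral_of_le ht0.le,
      intervalIntegral.integral_add_adjacent_intervals (hii _ _) (hii _ _)]
  have htail : |∫ u in (N:ℝ)..t, s u| ≤ B := by
    have h := intervalIntegral.norm_integral_le_of_norm_le_const (a := (N:ℝ)) (b := t) (C := B) (f := s)
      (fun u _ => by rw [Real.norm_eq_abs]; exact hB u)
    rw [Real.norm_eq_abs] at h
    calc |∫ u in (N:ℝ)..t, s u| ≤ B * |t - N| := h
      _ ≤ B * 1 := by gcongr; rw [abs_le]; constructor <;> linarith
      _ = B := mul_one B
  rw [Real.norm_eq_abs, abs_div, abs_of_pos ht0, hsplit]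
  calc |(∫ u in (0:ℝ)..N, s u) + ∫ u in (N:ℝ)..t, s u| / t
      ≤ (|∫ u in (0:ℝ)..N, s u| + B) / t := by
        gcongr
        exact (abs_add_le _ _).trans (by linarith [htail])
    _ = |∫ u in (0:ℝ)..N, s u| / t + B / t := add_div _ _ _
    _ ≤ |∫ u in (0:ℝ)..N, s u| / N + B / t := by gcongr
    _ = |(N:ℝ)⁻¹ * ∫ u in (0:ℝ)..N, s u| + B / t := by
        rw [abs_mul, abs_inv, Nat.abs_cast, inv_mul_eq_div]

/-! ### The a.e. group law: `(φ₁)^[n] = φ_n` on the carrier -/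

/-- On the carrier, the `n`-th iterate of the time-one map is the time-`n` map (group law `D.flow_add`). [folklore] -/
theorem iterate_flow_one_eq {P : OscillatorChain} (D : InfiniteChainDynamics P) {σ : ChainConfig}
    (hσ : σ ∈ D.carrier) (n : ℕ) : (D.flow 1)^[n] σ = D.flow n σ := by
  induction n with
  | zero => simp [D.flow_zero σ hσ]
  | succ n ih =>
      rw [iterate_succ_apply', ih, ← D.flow_add hσ 1 n]
      push_cast
      rw [add_comm]

/-! ### The stub -/

/-- **Stub `stub_noFrozenSiteEnergy_of_ergodic`** (edge "Erg" of line `Sketch` of `CageBudgetFekete.UnboundedHeatVariance`):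
in the arena of the crux, if the time-one map `D.flow 1` is ERGODIC for the state `μ`, then the site energy has NO
FROZEN COMPONENT: the on-site Abel mean `Sb ν 0 = ν ∫₀^∞ e^{-νt} S(0,t) dt` of the centred energy kernel
`S(0,t) = ∫ (h₀ - m)(h₀ ∘ φ_t - m) dμ` tends to `0` as `ν ↓ 0` — von Neumann's mean ergodic theorem for the Koopman
isometry of `φ₁` on the `φ_θ`-translates of the centred site energy (fixed vectors are constants), bounded
convergence in the phase `θ`, and Widder's Abelian theorem (Cesàro ⟹ Abel). [folklore] -/
theorem stub_noFrozenSiteEnergy_of_ergodic :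
    ∀ ω₂ lam β γ : ℝ, 0 < ω₂ → 0 < lam → 0 < β → ∀ T : ℝ, 0 < T → ∀ μ : MeasureTheory.Measure Literature.MathematicalPhysics.KineticTheory.HeatConduction.ChainConfig, (Literature.MathematicalPhysics.KineticTheory.HeatConduction.pinnedChain ω₂ lam β γ).IsChainGibbsMeasure T μ → Literature.MathematicalPhysics.KineticTheory.HeatConduction.IsShiftInvariant μ → μ.map (fun σ : Literature.MathematicalPhysics.KineticTheory.HeatConduction.ChainConfig => fun x : ℤ => ((σ x).1, -(σ x).2)) = μ → ∀ D : Literature.MathematicalPhysics.KineticTheory.HeatConduction.InfiniteChainDynamics (Literature.MathematicalPhysics.KineticTheory.HeatConduction.pinnedChain ω₂ lam β γ), D.PreservesMeasure μ → (∀ t : ℝ, ∀ᵐ σ ∂μ, D.flow t (Literature.MathematicalPhysics.KineticTheory.HeatConduction.shift σ) = Literature.MathematicalPhysics.KineticTheory.HeatConduction.shift (D.flow t σ)) → (∀ t : ℝ, D.HasAbsConvergentCorrelation μ t) → Continuous (fun t : ℝ => D.currentCorrelation μ t) → _root_.Ergodic (D.flow 1) μ → ∀ h : Literature.MathematicalPhysics.KineticTheory.HeatConduction.ChainConfig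 → ℤ → ℝ, h = (fun (σ : Literature.MathematicalPhysics.KineticTheory.HeatConduction.ChainConfig) (x : ℤ) => (σ x).2 ^ 2 / 2 + (Literature.MathematicalPhysics.KineticTheory.HeatConduction.pinnedChain ω₂ lam β γ).U (σ x).1 + ((Literature.MathematicalPhysics.KineticTheory.HeatConduction.pinnedChain ω₂ lam β γ).V ((σ (x + 1)).1 - (σ x).1) + (Literature.MathematicalPhysics.KineticTheory.HeatConduction.pinnedChain ω₂ lam β γ).V ((σ x).1 - (σ (x - 1)).1)) / 2) → ∀ S : ℤ → ℝ → ℝ, S = (fun (x : ℤ) (t : ℝ) => ∫ σ, (h σ 0 - ∫ σ', h σ' 0 ∂μ) * (h (D.flow t σ) x - ∫ σ', h σ' 0 ∂μ) ∂μ) → ∀ Sb : ℝ → ℤ → ℝ, Sb = (fun (ν : ℝ) (x : ℤ) => ν * ∫ t in Set.Ioi (0:ℝ), Real.exp (-(ν * t)) * S x t) → Filter.Tendsto (fun ν : ℝ => Sb ν 0) (nhdsWithin (0:ℝ) (Set.Ioi 0)) (nhds 0) := by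
  intro ω₂ lam β γ hω hl hβ T hT μ hG hSI hRefl D hP hShift _hAbs _hCont hErg h hh S hS Sb hSb
  /- §0 chain data: superstability, the centred site energy `f = h₀ - m ∈ L²(μ)` -/
  have hss : (pinnedChain ω₂ lam β γ).HasSuperstabilityEstimate μ :=
    OscillatorChain.hasSuperstabilityEstimate_of_isShiftInvariant_pinnedChain γ hω hl.le hβ.le hT hG hSI
  haveI : IsProbabilityMeasure μ := hss.1
  have hUm : Measurable (pinnedChain ω₂ lam β γ).U := OscillatorChain.measurable_pinnedChain_U ω₂ lam β γ
  have hVm : Measurable (pinnedChain ω₂ lam β γ).V := OscillatorChain.measurable_pinnedChain_V ω₂ lam β γ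
  set h0 : ChainConfig → ℝ := fun σ => (pinnedChain ω₂ lam β γ).energyDensityZ σ 0 with h0def
  have h0m : Measurable h0 := (pinnedChain ω₂ lam β γ).measurable_energyDensityZ hUm hVm 0
  have h02 : MemLp h0 2 μ :=
    OscillatorChain.memLp_energyDensityZ_pinnedChain γ hω.le hl.le hβ.le hss 0 ENNReal.ofNat_ne_top
  set m : ℝ := ∫ σ, h0 σ ∂μ with hmdef
  set f : ChainConfig → ℝ := fun σ => h0 σ - m with hfdef
  have hfm : Measurable f := h0m.sub_const m
  have hf2 : MemLp f 2 μ := h02.sub (memLp_const m)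
  have hf0 : ∫ σ, f σ ∂μ = 0 := by
    simp only [hfdef]
    rw [integral_sub (h02.integrable one_le_two) (integrable_const m), integral_const, probReal_univ,
      one_smul, sub_self]
  /- §1 the on-site kernel `s = S 0`: continuity, boundedness -/
  set s : ℝ → ℝ := fun t => ∫ σ, f σ * f (D.flow t σ) ∂μ with hsdef
  have hh' : ∀ (σ : ChainConfig) (x : ℤ), h σ x = (pinnedChain ω₂ lam β γ).energyDensityZ σ x := by
    intro σ x; subst hh; rfl
  have hS0 : S 0 = s := by
    funext t
    rw [hS]
    simp only [hh']
    rfl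
  have hmean : ∀ t : ℝ, ∫ σ, (h0 ∘ D.flow t) σ ∂μ = m := fun t =>
    integral_comp_eq_of_measurePreserving (hP.2 t) h0m
  have hs_eq : ∀ t : ℝ, s t = (∫ σ, h0 σ * h0 (D.flow t σ) ∂μ) - m * m := by
    intro t
    have hY2 : MemLp (h0 ∘ D.flow t) 2 μ := h02.comp_measurePreserving (hP.2 t)
    have hcov := ProbabilityTheory.covariance_eq_sub h02 hY2
    rw [ProbabilityTheory.covariance, hmean t] at hcov
    exact hcov
  have hsc : Continuous s := by
    have hc := InfiniteChainDynamics.continuous_integral_energyDensityZ_mul_flow_pinnedChain γ hω.le hl.le hβ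
      hss D hP 0 0
    have e : s = fun t => (∫ σ, h0 σ * h0 (D.flow t σ) ∂μ) - m * m := funext hs_eq
    rw [e]
    exact hc.sub continuous_const
  have hbd : ∀ t : ℝ, |s t| ≤ ∫ σ, f σ ^ 2 ∂μ := fun t => D.abs_integral_mul_comp_flow_le hP hfm hf2 t
  /- §2 von Neumann: Cesàro means along every integer progression vanish -/
  have hces : ∀ θ : ℝ, Tendsto (fun N : ℕ => (N : ℝ)⁻¹ * ∑ n ∈ Finset.range N, s (θ + n)) atTop (𝓝 0) := by
    intro θ
    have hg2 : MemLp (f ∘ D.flow θ) 2 μ := hf2.comp_measurePreserving (hP.2 θ)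
    have hv := tendsto_cesaro_integral_mul_comp_iterate_of_ergodic hErg hf2 hg2 hf0
    refine hv.congr fun N => ?_
    congr 1
    refine Finset.sum_congr rfl fun n _ => ?_
    refine integral_congr_ae ?_
    filter_upwards [hP.1] with σ hσ
    simp only [comp_apply]
    rw [iterate_flow_one_eq D hσ n, ← D.flow_add hσ θ n]
  /- §3 continuous Cesàro mean, then Cesàro ⟹ Abel (Widder) -/
  have hC : Tendsto (fun t : ℝ => (∫ u in Ioc 0 t, S 0 u) / t) atTop (𝓝 0) := by
    rw [hS0]
    exact tendsto_setIntegral_div_of_cesaro hsc hbd hces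
  have hloc : ∀ T' : ℝ, IntegrableOn (S 0) (Ioc 0 T') := fun T' => by
    rw [hS0]; exact hsc.integrableOn_Ioc
  have hlap : ∀ ν : ℝ, 0 < ν → IntegrableOn (fun t : ℝ => Real.exp (-(ν * t)) * S 0 t) (Ioi 0) := by
    obtain ⟨-, -, h3, -, -, -, -, -, -, -, -, -⟩ :=
      Summit.AtomisticToContinuum.FouriersLaw.Theorems.FibreCalculusSketch.fibreCalculus_proof ω₂ lam β γ hω hl hβ
        T hT μ hG hSI hRefl D hP hShift h hh S hS Sb hSb _ rfl _ rfl _ rfl _ rfl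
    exact fun ν hν => h3 0 ν hν
  have key := Literature.Analysis.Asymptotics.Widder1941_abelian_laplace_one
    Literature.Analysis.Asymptotics.Widder1941_abelian_laplace_holds (S 0) 0 hloc hlap hC
  subst hSb
  exact key

/-- **Corollary (Erg ∘ E): ergodicity of the time-one map ⟹ infrared non-freezing.** In the arena of the crux,
with the energy kernel `S`, its Abel profile `Sb`, the Abel structure factor `fh ν k = Σ_x cos(kx) Sb ν x` and the
static one `χk k = Σ_x cos(kx) S x 0`: if `D.flow 1` is ergodic for `μ`, then for every `M` and every `ν₁ > 0`
some wavenumber `k` with `cos k ≠ 1` and some `0 < ν < ν₁` have Abel deficit `χk k - fh ν k ≥ M (2 - 2 cos k)`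
(`stub_noFrozenSiteEnergy_of_ergodic` fed into the landed `stub_infraredNonFreezingOfNoFrozenSiteEnergy`). [folklore] -/
theorem infraredNonFreezing_of_ergodic :
    ∀ ω₂ lam β γ : ℝ, 0 < ω₂ → 0 < lam → 0 < β → ∀ T : ℝ, 0 < T → ∀ μ : MeasureTheory.Measure Literature.MathematicalPhysics.KineticTheory.HeatConduction.ChainConfig, (Literature.MathematicalPhysics.KineticTheory.HeatConduction.pinnedChain ω₂ lam β γ).IsChainGibbsMeasure T μ → Literature.MathematicalPhysics.KineticTheory.HeatConduction.IsShiftInvariant μ → μ.map (fun σ : Literature.MathematicalPhysics.KineticTheory.HeatConduction.ChainConfig => fun x : ℤ => ((σ x).1, -(σ x).2)) = μ → ∀ D : Literature.MathematicalPhysics.KineticTheory.HeatConduction.InfiniteChainDynamics (Literature.MathematicalPhysics.KineticTheory.HeatConduction.pinnedChain ω₂ lam β γ), D.PreservesMeasure μ → (∀ t : ℝ, ∀ᵐ σ ∂μ, D.flow t (Literature.MathematicalPhysics.KineticTheory.HeatConduction.shift σ) = Literature.MathematicalPhysics.KineticTheory.HeatConduction.shift (D.flow t σ)) → (∀ t :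 ℝ, D.HasAbsConvergentCorrelation μ t) → Continuous (fun t : ℝ => D.currentCorrelation μ t) → _root_.Ergodic (D.flow 1) μ → ∀ h : Literature.MathematicalPhysics.KineticTheory.HeatConduction.ChainConfig → ℤ → ℝ, h = (fun (σ : Literature.MathematicalPhysics.KineticTheory.HeatConduction.ChainConfig) (x : ℤ) => (σ x).2 ^ 2 / 2 + (Literature.MathematicalPhysics.KineticTheory.HeatConduction.pinnedChain ω₂ lam β γ).U (σ x).1 + ((Literature.MathematicalPhysics.KineticTheory.HeatConduction.pinnedChain ω₂ lam β γ).V ((σ (x + 1)).1 - (σ x).1) + (Literature.MathematicalPhysics.KineticTheory.HeatConduction.pinnedChain ω₂ lam β γ).V ((σ x).1 - (σ (x - 1)).1)) / 2) → ∀ S : ℤ → ℝ → ℝ, S = (fun (x : ℤ) (t : ℝ) => ∫ σ, (h σ 0 - ∫ σ', h σ' 0 ∂μ) * (h (D.flow t σ) x - ∫ σ', h σ' 0 ∂μ) ∂μ) → ∀ Sb : ℝ → ℤ → ℝ, Sb = (fun (ν : ℝ) (x : ℤ) => ν * ∫ t in Set.Ioi (0:ℝ), Real.exp (-(ν * t))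 * S x t) → ∀ fh : ℝ → ℝ → ℝ, fh = (fun (ν k : ℝ) => ∑' x : ℤ, Real.cos (k * (x : ℝ)) * Sb ν x) → ∀ χk : ℝ → ℝ, χk = (fun k : ℝ => ∑' x : ℤ, Real.cos (k * (x : ℝ)) * S x 0) → ∀ M ν₁ : ℝ, 0 < ν₁ → ∃ k : ℝ, Real.cos k ≠ 1 ∧ ∃ ν : ℝ, 0 < ν ∧ ν < ν₁ ∧ M * (2 - 2 * Real.cos k) ≤ χk k - fh ν k := by
  intro ω₂ lam β γ hω hl hβ T hT μ hG hSI hRefl D hP hShift hAbs hCont hErg h hh S hS Sb hSb fh hfh χk hχk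
  exact stub_infraredNonFreezingOfNoFrozenSiteEnergy ω₂ lam β γ hω hl hβ T hT μ hG hSI hRefl D hP hShift hAbs hCont
    h hh S hS Sb hSb fh hfh χk hχk
    (stub_noFrozenSiteEnergy_of_ergodic ω₂ lam β γ hω hl hβ T hT μ hG hSI hRefl D hP hShift hAbs hCont hErg
      h hh S hS Sb hSb)

end Summit.AtomisticToContinuum.FouriersLaw.Theorems.UnboundedHeatVariance.Sketch

end
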